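import Summits.ResolutionOfSingularities.ResolutionOfSingularities.Theorems.PAlterationPialtSqueeze
import Summits.ResolutionOfSingularities.ResolutionOfSingularities.Theorems.PAlterationPalterationThesisIffSummit
import Literature.AlgebraicGeometry.Resolution.ProperModelsPatchingOfResolution
import HarnessLib

/-!
# `Pialt` (crux stmt-ResolutionOfSingularities-0555), line `SketchIdeator2` / Card A: what the squeeze
# means for the route and the summit

Helper file of the line lead (c1), companion of `Theorems/PAlterationPialtSqueeze.lean`
(`--supports stmt-ResolutionOfSingularities-0555`; it does not close any item).

The squeeze (`pialt_of_temkin2013_picover_twoModelPatching`: `Temkin2013 ∧ Picover ∧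
(∀ p, TwoModelPatching p) ⇒ Pialt`) composed with the route's landed frame
(`palterationThesis_iff_pialt_and_picover`, `resolutionOfSingularities_iff_pialt_and_picover` —
the by-name assembly `Assembly2` through the proved `PicoverToRadicialBottom` and
`DescentReducedToIntegral`, EVERY ground field) gives:

* `palterationThesis_of_temkin2013_picover_twoModelPatching` — the route's thesis (stmt-0552)
  from `Temkin2013 ∧ Picover ∧ (∀ p, TwoModelPatching p)`;
* `resolutionOfSingularities_of_temkin2013_picover_twoModelPatching` — **the SUMMIT from the
  published theorem `Temkin2013` (Temkin 2013, Thm. 1.3.2) and two open statements, `Picover`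
  (crux stmt-0554: resolution of finite radicial covers of regular varieties) and Piltant's
  two-model patching of proper models `ProperModel.TwoModelPatching p` (the atom of crux
  stmt-0642), over ALL fields of every positive characteristic** — the crux `Pialt` (stmt-0555)
  and the descent cruxes are bypassed;
* `resolutionOfSingularities_iff_picover_and_twoModelPatching` — and since both statements are
  consequences of the summit (`picover_of_resolutionOfSingularities`,
  `ProperModel.twoModelPatching_of_resolutionInChar`): **modulo `Temkin2013`,
  `ResolutionOfSingularities ↔ Picover ∧ (∀ p, TwoModelPatching p)`** — an exact two-atom
  decomposition of resolution of singularities in positive characteristic into the "inseparable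
  case" (Temkin 2013, Rem. 1.3.5 (iii)) and Zariski–Piltant patching (Piltant 2013, Prop. 5.1,
  open in transcendence degree `≥ 4`).

Mechanism, for the record: atoms ⇒ classical LU over perfect fields (Temkin's p.i. extension is
absorbed by `Picover` through the normal RR model `B ∩ K` and Frobenius domination) ⇒ resolution
over perfect fields (Zariski–Piltant engine) ⇒ `Pialt` over all fields (perfect fields suffice
for `Pialt`: descent from the perfect closure) ⇒ with `Picover` again, the route's assembly
(normalise `X` in the alteration, resolve the radicial bottom) ⇒ summit over all fields.

Sources: M. Temkin, J. Algebra 373 (2013), Thm. 1.3.2, Rem. 1.3.5; O. Piltant, RACSAM 107 (2013),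
Prop. 5.1; D. Abramovich, F. Oort, Progr. Math. 181 (2000), Q. 2.13.
-/

set_option linter.dupNamespace false -- mandated namespace of this single-conjunct summit

noncomputable section

open CategoryTheory AlgebraicGeometry
open Literature.AlgebraicGeometry.Resolution

namespace Summit.ResolutionOfSingularities.ResolutionOfSingularities.Theorems.Pialt.RadiciallyRegular

open Summit.ResolutionOfSingularities.ResolutionOfSingularities.Theses.PAlteration
  (Pialt Picover PalterationThesis)

/-- **The route's thesis from the atoms**: `Temkin2013 ∧ Picover ∧ (∀ p, TwoModelPatching p)`
imply `PalterationThesis` (stmt-0552: `Pialt ∧ Picover` for every prime), by the squeeze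
`pialt_of_temkin2013_picover_twoModelPatching` and `palterationThesis_of_pialt_of_picover`.
[folklore] -/
theorem palterationThesis_of_temkin2013_picover_twoModelPatching (hT : Temkin2013.{0})
    (hPc : Picover) (hZ : ∀ p : ℕ, p.Prime → ProperModel.TwoModelPatching.{0} p) :
    PalterationThesis :=
  palterationThesis_of_pialt_of_picover (pialt_of_temkin2013_picover_twoModelPatching hT hPc hZ) hPc

/-- **Resolution of singularities in positive characteristic from `Temkin2013`, `Picover` and
two-model patching.** For every prime `p`, every field `k` of characteristic `p` (ANY field) and
every reduced separated `k`-scheme of finite type: a resolution exists, granted Temkin's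
inseparable local uniformization (published), resolution of finite radicial covers of regular
varieties (`Picover`, crux stmt-0554) and Piltant's two-model patching of proper models in every
prime characteristic (the atom of crux stmt-0642). Route frame:
`resolutionOfSingularities_iff_pialt_and_picover`. [folklore] -/
theorem resolutionOfSingularities_of_temkin2013_picover_twoModelPatching (hT : Temkin2013.{0})
    (hPc : Picover) (hZ : ∀ p : ℕ, p.Prime → ProperModel.TwoModelPatching.{0} p) :
    _root_.ResolutionOfSingularities :=
  resolutionOfSingularities_iff_pialt_and_picover.mpr
    ⟨pialt_of_temkin2013_picover_twoModelPatching hT hPc hZ, hPc⟩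

/-- **Modulo `Temkin2013`, the summit is EQUIVALENT to `Picover ∧ (∀ p, TwoModelPatching p)`**:
`←` is `resolutionOfSingularities_of_temkin2013_picover_twoModelPatching`; `→` holds outright
(`picover_of_resolutionOfSingularities`: a radicial cover of a regular variety is in particular a
variety; `ProperModel.twoModelPatching_of_resolutionInChar`: resolve the join of the two models).
So resolution of singularities in positive characteristic splits exactly into the "inseparable
case" (Temkin 2013, Rem. 1.3.5 (iii)) and Zariski–Piltant patching (Piltant 2013, Prop. 5.1),
both open from dimension `4`. [folklore] -/
theorem resolutionOfSingularities_iff_picover_and_twoModelPatching (hT : Temkin2013.{0}) :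
    _root_.ResolutionOfSingularities ↔
      (Picover ∧ ∀ p : ℕ, p.Prime → ProperModel.TwoModelPatching.{0} p) :=
  ⟨fun h => ⟨picover_of_resolutionOfSingularities h,
      fun p hp => ProperModel.twoModelPatching_of_resolutionInChar (h p hp)⟩,
    fun h => resolutionOfSingularities_of_temkin2013_picover_twoModelPatching hT h.1 h.2⟩

end Summit.ResolutionOfSingularities.ResolutionOfSingularities.Theorems.Pialt.RadiciallyRegular

end
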